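import Mathlib
import Literature.NumberTheory.LFunctions.Zhang2022.Section4RoucheInner
import HarnessLib

/-!
# Zhang (2022), §4: Lemma 4.7 and Prop. 2.2 (iii) from LOCATED zeros, and from (4.12) on `Re w > −α`
# (companion of `Section4RoucheInner`)

Topic `Literature/NumberTheory/LFunctions/Zhang2022` (Landau–Siegel audit tree; verdict-neutral).
Y. Zhang, *Discrete mean estimates and the Landau–Siegel zero*, arXiv:2211.02515v1 (2022)
[Zhang2022LandauSiegel] — **an unrefereed manuscript under adjudication**; CLAIM nodes stated not
asserted. DAG nodes `Z22:Lem4.7` and `Z22:Prop2.2` (iii). Given a `c′`-indexed family of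
located-zero statements "the zero set of `𝒜(ρ+·,ψ)` in `|w| < α(1+c′α𝓛)` is `{0, iα+v₁, −iα+v₋₁}`,
`|v_{±1}| < c′α²𝓛`" (as produced by `Section4Lemma47Rouche.three_zeros_of_rouche` from the full
(4.12), or by `Section4RoucheInner.three_zeros_of_rouche_inner` from (4.12) on `Re w > −α` only):

* `lemma47_of_three_zeros` — the banked `Skeleton.Lemma47 c′` (three distinct zeros);
* `prop22iii_of_three_zeros` — with Lemma 4.2 and Prop. 2.2 (i), the banked full-window gap assertion
  `Skeleton.Prop22iii c′` (the argument of `Section4Prop22iiiRouche.prop22iii_of_rouche`: the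
  located point `s + iα + v₁` is a zero of `L·L` strictly above `s`, in `Ω` or above its window,
  so `γ′ − γ − α ≤ Im v₁`; and `s′ − s ∈ {iα+v₁, −iα+v₋₁}` forces `γ′ − γ − α = Im v₁`);
* `lemma47_of_rouche_inner`, `prop22iii_of_rouche_inner` — the two nodes from Rouché (binder),
  Lemma 4.2 and the half-disc (4.12), i.e. VERBATIM the conclusion of the tree's
  `Section4.eq412_inner_of : Lemma42 → Lemma43 → Eq46 → Eq410 → …` — so Lemma 4.7 and Prop. 2.2 (iii)
  need (4.10) on `Ω₃` only (GAP row G-L1t7-1 is immaterial for them).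

What is NOT asserted: Rouché (binder); Lemma 4.2; (4.12); Prop. 2.2 (i). Nothing about
Theorems 1–2 of the source is stated or implied; nothing here bears on the verdict on (8.24).

## References

* Y. Zhang, arXiv:2211.02515v1 (2022), §4 p. 23 (Lemma 4.7), §2 p. 5 (Prop. 2.2 (iii)).
  [cite: Zhang2022LandauSiegel, §4 Lemma 4.7; §2 Prop. 2.2 (iii)]
-/

noncomputable section

open Complex Real Set Filter Topology

namespace Literature.NumberTheory.LFunctions.Zhang2022.Section4

open Literature.NumberTheory.LFunctions.Zhang2022.Skeleton

variable {D : ℕ} [NeZero D] (χ : DirichletCharacter ℂ D)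

/-- **Lemma 4.7 from the located zeros** (`Z22:Lem4.7`): any `c′`-indexed family of "the zero
set of `𝒜(ρ+·)` in `|w| < α(1+c′α𝓛)` is `{0, iα+v₁, −iα+v₋₁}` with `|v_{±1}| < c′α²𝓛`" (as produced
by `three_zeros_of_rouche` / `three_zeros_of_rouche_inner`) yields the node `Skeleton.Lemma47 c′`
(`ncard = 3`; `c′α²𝓛 < α` for `D` large). [cite: Zhang2022LandauSiegel, §4 Lemma 4.7] -/
theorem lemma47_of_three_zeros {c₀ : ℝ}
    (h3 : ∀ c' : ℝ, c₀ ≤ c' →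
      ForAllLarge fun D _ χ => ∀ x ∈ PsiOne χ, ∀ ρ : ℂ, calA χ x ρ = 0 → ρ.re = 1 / 2 →
        |ρ.im - 2 * π * t0 D| < ell1 D + 2 →
          ∃ v₁ vm : ℂ, ‖v₁‖ < c' * alpha D ^ 2 * ell D ∧ ‖vm‖ < c' * alpha D ^ 2 * ell D ∧
            {w : ℂ | ‖w‖ < alpha D * (1 + c' * alpha D * ell D) ∧ calA χ x (ρ + w) = 0} =
              {(0 : ℂ), I * (alpha D : ℂ) + v₁, -(I * (alpha D : ℂ)) + vm}) :
    ∀ c' : ℝ, c₀ ≤ c' → Lemma47 c' := by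
  intro c' hc'
  obtain ⟨D₁, hD₁, hδD⟩ := exists_delta_le c' (1 / 200) (by norm_num)
  obtain ⟨D₀, hD₀⟩ := h3 c' hc'
  refine ⟨max D₀ D₁, fun D _ χ hD hq hp x hx ρ hAρ hre hγ => ?_⟩
  have hDD₀ : D₀ ≤ D := le_trans (le_max_left _ _) hD
  have hDD₁ : D₁ ≤ D := le_trans (le_max_right _ _) hD
  have hD2 : 2 ≤ D := le_trans hD₁ hDD₁
  have hℓ0 : 0 < ell D := Real.log_pos (by exact_mod_cast hD2)
  have hα : 0 < alpha D := by
    rw [Section2.alpha_eq_pi_div_ell9]; exact div_pos Real.pi_pos (pow_pos hℓ0 9)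
  obtain ⟨v₁, vm, hv₁, hvm, hset⟩ := hD₀ D χ hDD₀ hq hp x hx ρ hAρ hre hγ
  have hsmall : c' * alpha D ^ 2 * ell D < alpha D := by
    have hδ := hδD D hDD₁
    have : c' * alpha D ^ 2 * ell D = (c' * alpha D * ell D) * alpha D := by ring
    rw [this]; nlinarith
  rw [hset]
  exact ncard_three_points hα (hv₁.trans hsmall) (hvm.trans hsmall)

/-- **Lemma 4.7 from (4.12) on `Re w > −α`, modulo Rouché** (`Z22:Lem4.7` + `Z22:Lem4.7.pf`): the
hypothesis `h412` is VERBATIM the conclusion of the tree's `Section4.eq412_inner_of : Lemma42 →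
Lemma43 → Eq46 → Eq410 → …` (so no use of (4.10) outside `Ω₃` is needed for Lemma 4.7 — the GAP row
G-L1t7-1 is immaterial for this node). [cite: Zhang2022LandauSiegel, §4 Lemma 4.7] -/
theorem lemma47_of_rouche_inner
    (hRouche : ∀ (f g : ℂ → ℂ) (c : ℂ) (r : ℝ), 0 < r →
      (∃ U : Set ℂ, IsOpen U ∧ Metric.closedBall c r ⊆ U ∧ DifferentiableOn ℂ f U ∧
        DifferentiableOn ℂ g U) →
      (∀ z ∈ Metric.sphere c r, ‖f z - g z‖ < ‖g z‖) →
      ∑ᶠ z ∈ Metric.ball c r, analyticOrderNatAt f z =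
        ∑ᶠ z ∈ Metric.ball c r, analyticOrderNatAt g z)
    (h42 : Lemma42)
    (h412 : ∃ C : ℝ, ForAllLarge fun D _ χ => ∀ x ∈ PsiOne χ, ∀ ρ ∈ lemma46Region D,
      calA χ x ρ = 0 → ∀ w : ℂ, ‖w‖ < 2 * alpha D → -alpha D < w.re →
        ‖calA χ x (1 / 2 + ρ.im * I + w) - (1 - Pm2w D w)‖ ≤ C * (alpha D * ell D)) :
    ∃ c₀ : ℝ, ∀ c' : ℝ, c₀ ≤ c' → Lemma47 c' := by
  obtain ⟨c₀, h3⟩ := three_zeros_of_rouche_inner hRouche h42 h412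
  exact ⟨c₀, lemma47_of_three_zeros h3⟩

/-- **Proposition 2.2 (iii) from the located zeros** (`Z22:Prop2.2` (iii)): with Lemma 4.2
(`F ≠ 0` near the line, so the located point `s + iα + v₁` is a zero of `L·L`) and Prop. 2.2 (i),
any `c′`-indexed family of located-zero statements (as produced by `three_zeros_of_rouche` /
`three_zeros_of_rouche_inner`) gives the banked full-window gap assertion `Skeleton.Prop22iii c′`
— the argument of `prop22iii_of_rouche` with the located zeros as an explicit input.
[cite: Zhang2022LandauSiegel, §2 Prop. 2.2 (iii)] -/
theorem prop22iii_of_three_zeros {c₀ : ℝ} (h42 : Lemma42) (hi : Prop22i)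
    (h3 : ∀ c' : ℝ, c₀ ≤ c' →
      ForAllLarge fun D _ χ => ∀ x ∈ PsiOne χ, ∀ ρ : ℂ, calA χ x ρ = 0 → ρ.re = 1 / 2 →
        |ρ.im - 2 * π * t0 D| < ell1 D + 2 →
          ∃ v₁ vm : ℂ, ‖v₁‖ < c' * alpha D ^ 2 * ell D ∧ ‖vm‖ < c' * alpha D ^ 2 * ell D ∧
            {w : ℂ | ‖w‖ < alpha D * (1 + c' * alpha D * ell D) ∧ calA χ x (ρ + w) = 0} =
              {(0 : ℂ), I * (alpha D : ℂ) + v₁, -(I * (alpha D : ℂ)) + vm}) :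
    ∀ c' : ℝ, c₀ ≤ c' → Prop22iii c' := by
  obtain ⟨C₂, h42'⟩ := h42
  intro c' hc'
  obtain ⟨D₁, hD₁, hδD⟩ := exists_delta_le c' (1 / 200) (by norm_num)
  obtain ⟨D₀, hD₀⟩ := ((h3 c' hc').and hi).and h42'
  refine ⟨max (max D₀ D₁) (max 3 ⌈Real.exp (max 3 (2 * C₂))⌉₊),
    fun D _ χ hD hq hp x hx s hs s' hs' hlt hcons => ?_⟩
  -- thresholds
  have hDD₀ : D₀ ≤ D := le_trans (le_trans (le_max_left _ _) (le_max_left _ _)) hD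
  have hDD₁ : D₁ ≤ D := le_trans (le_trans (le_max_right _ _) (le_max_left _ _)) hD
  have hD3 : 3 ≤ D := le_trans (le_trans (le_max_left _ _) (le_max_right _ _)) hD
  have hDe : ⌈Real.exp (max 3 (2 * C₂))⌉₊ ≤ D :=
    le_trans (le_trans (le_max_right _ _) (le_max_right _ _)) hD
  obtain ⟨hℓ3, hℓC⟩ := max_le_iff.mp (le_ell_of_ceil_exp_le hDe)
  have hℓ0 : 0 < ell D := by linarith
  have hℓ1 : 1 ≤ ell D := by linarith
  obtain ⟨⟨e3, ei⟩, e42⟩ := hD₀ D χ hDD₀ hq hp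
  -- parameters: `α`, the bound `b = c′α²𝓛 = (c′α𝓛)·α ≤ α/200`
  have hα : 0 < alpha D := by
    rw [Section2.alpha_eq_pi_div_ell9]; exact div_pos Real.pi_pos (pow_pos hℓ0 9)
  have hαsmall : alpha D ≤ 1 / 1000 := alpha_le_of_three_le_ell hℓ3
  set b : ℝ := c' * alpha D ^ 2 * ell D with hb
  have hδ : c' * alpha D * ell D ≤ 1 / 200 := hδD D hDD₁
  have hbα : b ≤ alpha D / 200 := by
    have : b = (c' * alpha D * ell D) * alpha D := by rw [hb]; ring
    rw [this]; nlinarith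
  have hRb : alpha D * (1 + c' * alpha D * ell D) = alpha D + b := by rw [hb]; ring
  -- the two consecutive zeros: on the line, in the window, zeros of `𝒜`
  have hre : s.re = 1 / 2 := ei x hx s hs
  have hre' : s'.re = 1 / 2 := ei x hx s' hs'
  have hAs : calA χ x s = 0 := calA_eq_zero_of_mem_prodZeroSetOmega χ x hs
  have hAs' : calA χ x s' = 0 := calA_eq_zero_of_mem_prodZeroSetOmega χ x hs'
  have hγ : |s.im - 2 * π * t0 D| < ell1 D + 2 := by
    have h := hs.1.2; rwa [Complex.sub_im, s0_im] at h
  have hγ' : |s'.im - 2 * π * t0 D| < ell1 D + 2 := by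
    have h := hs'.1.2; rwa [Complex.sub_im, s0_im] at h
  obtain ⟨hγl, hγu⟩ := abs_lt.mp hγ
  obtain ⟨hγl', hγu'⟩ := abs_lt.mp hγ'
  -- the located zeros of `𝒜(s + ·)`
  obtain ⟨v₁, vm, hv₁, hvm, hset⟩ := e3 x hx s hAs hre hγ
  have hv₁im : |v₁.im| < b := lt_of_le_of_lt (Complex.abs_im_le_norm v₁) hv₁
  have hv₁re : |v₁.re| < b := lt_of_le_of_lt (Complex.abs_re_le_norm v₁) hv₁
  have hvmim : |vm.im| < b := lt_of_le_of_lt (Complex.abs_im_le_norm vm) hvm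
  obtain ⟨hv₁im1, hv₁im2⟩ := abs_lt.mp hv₁im
  obtain ⟨hv₁re1, hv₁re2⟩ := abs_lt.mp hv₁re
  obtain ⟨-, hvmim2⟩ := abs_lt.mp hvmim
  -- the zero `a = s + iα + v₁` above `s`
  set w₁ : ℂ := I * (alpha D : ℂ) + v₁ with hw₁
  have hw₁mem : w₁ ∈ ({(0 : ℂ), I * (alpha D : ℂ) + v₁, -(I * (alpha D : ℂ)) + vm} : Set ℂ) := by
    simp [hw₁]
  rw [← hset] at hw₁mem
  obtain ⟨hw₁R, hAa⟩ := hw₁mem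
  have hw₁im : w₁.im = alpha D + v₁.im := by simp [hw₁]
  have hw₁re : w₁.re = v₁.re := by simp [hw₁]
  have haim : (s + w₁).im = s.im + alpha D + v₁.im := by rw [Complex.add_im, hw₁im]; ring
  have hare : (s + w₁).re = 1 / 2 + v₁.re := by rw [Complex.add_re, hw₁re, hre]
  -- `F(a) ≠ 0` (Lemma 4.2: `a ∈ Ω₁`), so `a` is a zero of `L·L`
  have hρeq : (1 / 2 : ℂ) + (s.im : ℂ) * I = s := by
    apply Complex.ext <;> simp [hre]
  have hw₁2α : ‖w₁‖ < 2 * alpha D := by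
    have : alpha D * (1 + c' * alpha D * ell D) < 2 * alpha D := by rw [hRb]; linarith
    exact hw₁R.trans this
  have hΩ1 : s + w₁ ∈ Omega1 D := by
    have h := half_add_mem_Omega1 hℓ3 hγ hw₁2α
    rwa [hρeq] at h
  have hhalf : C₂ * (ell D ^ 227)⁻¹ ≤ 1 / 2 := by
    have h227 : ell D ≤ ell D ^ 227 := by
      calc ell D = ell D ^ 1 := (pow_one _).symm
        _ ≤ ell D ^ 227 := pow_le_pow_right₀ hℓ1 (by norm_num)
    rw [← div_eq_mul_inv, div_le_iff₀ (pow_pos hℓ0 _)]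
    linarith
  have hFa : Fpoly χ x (s + w₁) ≠ 0 :=
    (inv_norm_le_two_mul_of_norm_mul_sub_one_le ((e42 x hx _ hΩ1).trans hhalf)).1
  have hLLa : LL χ x (s + w₁) = 0 := by
    have h := hAa
    rw [calA, div_eq_zero_iff] at h
    exact h.resolve_right hFa
  -- `γ′ ≤ Im a`: otherwise `a` would be a zero of `L·L` in `Ω` strictly between `s` and `s′`
  have hle : s'.im ≤ (s + w₁).im := by
    by_contra hlt'
    push Not at hlt'
    have hgt : s.im < (s + w₁).im := by rw [haim]; linarith
    have haΩ : s + w₁ ∈ Omega D := by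
      refine ⟨?_, ?_⟩
      · rw [Complex.sub_re, s0_re, hare]
        rw [abs_lt]; constructor <;> linarith
      · rw [Complex.sub_im, s0_im]
        rw [abs_lt]; constructor <;> linarith
    exact hcons (s + w₁) ⟨haΩ, hLLa⟩ ⟨hgt, hlt'⟩
  have hupper : s'.im - s.im - alpha D < b := by rw [haim] at hle; linarith
  -- `s′ − s` is a non-zero zero of `𝒜(s + ·)` in the big disc, hence `= iα + v₁`
  have hlower : -b < s'.im - s.im - alpha D := by
    set w' : ℂ := s' - s with hw'
    have hw'eq : w' = ((s'.im - s.im : ℝ) : ℂ) * I := by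
      apply Complex.ext <;> simp [hw', hre, hre']
    have hw'norm : ‖w'‖ = s'.im - s.im := by
      rw [hw'eq, norm_mul, Complex.norm_real, Complex.norm_I, mul_one,
        Real.norm_of_nonneg (by linarith)]
    have hw'im : w'.im = s'.im - s.im := by simp [hw']
    have hw'R : ‖w'‖ < alpha D * (1 + c' * alpha D * ell D) := by
      rw [hRb, hw'norm]; linarith
    have hw'z : calA χ x (s + w') = 0 := by
      have : s + w' = s' := by rw [hw']; ring
      rw [this]; exact hAs'
    have hw'mem : w' ∈ {w : ℂ | ‖w‖ < alpha D * (1 + c' * alpha D * ell D) ∧ calA χ x (s + w) = 0} :=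
      ⟨hw'R, hw'z⟩
    rw [hset] at hw'mem
    simp only [Set.mem_insert_iff, Set.mem_singleton_iff] at hw'mem
    rcases hw'mem with h0 | h1 | hm
    · -- `w′ = 0` contradicts `γ < γ′`
      have : w'.im = 0 := by rw [h0]; simp
      rw [hw'im] at this; linarith
    · -- `w′ = iα + v₁`
      have : w'.im = alpha D + v₁.im := by rw [h1, hw₁im]
      rw [hw'im] at this; linarith
    · -- `w′ = −iα + v₋₁` has negative imaginary part
      have : w'.im = -alpha D + vm.im := by rw [hm]; simp
      rw [hw'im] at this
      have : b < alpha D := by linarith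
      linarith
  exact abs_lt.mpr ⟨hlower, hupper⟩


/-- **Proposition 2.2 (iii) from (4.12) on `Re w > −α` and Prop. 2.2 (i), modulo Rouché**
(`Z22:Prop2.2` (iii)); `h412` is VERBATIM the conclusion of the tree's `Section4.eq412_inner_of`.
[cite: Zhang2022LandauSiegel, §2 Prop. 2.2 (iii)] -/
theorem prop22iii_of_rouche_inner
    (hRouche : ∀ (f g : ℂ → ℂ) (c : ℂ) (r : ℝ), 0 < r →
      (∃ U : Set ℂ, IsOpen U ∧ Metric.closedBall c r ⊆ U ∧ DifferentiableOn ℂ f U ∧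
        DifferentiableOn ℂ g U) →
      (∀ z ∈ Metric.sphere c r, ‖f z - g z‖ < ‖g z‖) →
      ∑ᶠ z ∈ Metric.ball c r, analyticOrderNatAt f z =
        ∑ᶠ z ∈ Metric.ball c r, analyticOrderNatAt g z)
    (h42 : Lemma42)
    (h412 : ∃ C : ℝ, ForAllLarge fun D _ χ => ∀ x ∈ PsiOne χ, ∀ ρ ∈ lemma46Region D,
      calA χ x ρ = 0 → ∀ w : ℂ, ‖w‖ < 2 * alpha D → -alpha D < w.re →
        ‖calA χ x (1 / 2 + ρ.im * I + w) - (1 - Pm2w D w)‖ ≤ C * (alpha D * ell D))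
    (hi : Prop22i) : ∃ c₀ : ℝ, ∀ c' : ℝ, c₀ ≤ c' → Prop22iii c' := by
  obtain ⟨c₀, h3⟩ := three_zeros_of_rouche_inner hRouche h42 h412
  exact ⟨c₀, prop22iii_of_three_zeros h42 hi h3⟩

end Literature.NumberTheory.LFunctions.Zhang2022.Section4
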